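import Summits.HubbardSuperconductivity.HubbardSuperconductivity.Theorems.NodalDiracTwistDiskTrivialHolonomyGrid
import Literature.MathematicalPhysics.QuantumLattice.SectorEigenvalueContinuation

/-!
# Route `NodalDiracTwist` — crux `NodalDiracWeakCoupling`: first-order energy estimates, lemmas

Helper file for stmt-HubbardSuperconductivity-10370 (`NodalDiracWeakCoupling`), supporting the
stub `stub_coneEnergy` of the line `birth` (first-order perturbation theory of a two-fold
degenerate lowest sector eigenvalue, Kato, *Perturbation Theory for Linear Operators* (1966),
II §5). Elementary linear algebra of the sesquilinear dot product `⟨x, y⟩ = star x ⬝ᵥ y` on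
`ι → ℂ`, with `‖x‖² := re ⟨x, x⟩`:
* Cauchy–Schwarz `|⟨x, y⟩| ≤ ‖x‖ ‖y‖`, normalisation, scaling of form bounds from unit vectors
  to all vectors (`norm_form_le_of_unit`) — positivity of `re ⟨x, x⟩` and the Hermitian symmetry
  of `⟨x, A y⟩` are taken from `SectorEigenvalueContinuation` (`EigenvalueContinuation.*`);
* expansions along an orthonormal pair `e₁, e₂` (`star_frame_dotProduct`, `dotProduct_frame`,
  `frame_decomp`: `ψ = c₁ e₁ + c₂ e₂ + χ` with `χ ⊥ e₁, e₂` and Pythagoras);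
* the compression of a matrix `W` to the plane of `e₁, e₂` (`compression_re`): with
  `s_kl = ⟨e_k, W e_l⟩`, `α = (re s₁₁ + re s₂₂)/2`, `a = (re s₁₁ - re s₂₂)/2`,
  `b = (s₁₂ + conj s₂₁)/2`, `re ⟨x₁e₁ + x₂e₂, W (x₁e₁ + x₂e₂)⟩ = α |x|² + q(x)` with the pencil
  form `q(x) = a(|x₁|² - |x₂|²) + 2 re(x̄₁ x₂ b)`;
* the pencil bounds `|q(x)| ≤ √(a² + |b|²) |x|²` (`abs_pencil_le`) and the lower eigenvector
  `q(x) = -√(a² + |b|²)`, `|x| = 1` (`exists_pencil_eq_neg_sqrt`).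
No new definitions.
-/

-- the mandated namespace `Summit.<Summit>.<Problem>.Theorems` repeats `HubbardSuperconductivity`
-- (single-problem summit, D-0017), which the `dupNamespace` linter flags on every declaration
set_option linter.dupNamespace false

namespace Summit.HubbardSuperconductivity.HubbardSuperconductivity.Theorems.NodalDiracTwist

open Matrix Complex Literature.MathematicalPhysics.QuantumLattice
open scoped ComplexOrder

variable {ι : Type*} [Fintype ι]

/-! ### The sesquilinear dot product: norms, Cauchy–Schwarz, scaling -/

/-- `⟨x, x⟩` is the real number `re ⟨x, x⟩`. [folklore] -/
theorem star_dotProduct_self_ofReal (x : ι → ℂ) :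
    star x ⬝ᵥ x = (((star x ⬝ᵥ x).re : ℝ) : ℂ) := by
  rw [star_dotProduct_self_re, star_dotProduct_self_eq_sum]

/-- **Cauchy–Schwarz** for the sesquilinear dot product: `|⟨x, y⟩| ≤ ‖x‖ ‖y‖` with
`‖x‖ = √(re ⟨x, x⟩)`. [folklore] -/
theorem norm_star_dotProduct_le_sqrt_mul_sqrt (x y : ι → ℂ) :
    ‖star x ⬝ᵥ y‖ ≤ Real.sqrt (star x ⬝ᵥ x).re * Real.sqrt (star y ⬝ᵥ y).re := by
  rw [star_dotProduct_self_re, star_dotProduct_self_re, dotProduct,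
    ← Real.sqrt_mul (Finset.sum_nonneg fun i _ => sq_nonneg ‖x i‖)]
  refine (norm_sum_le _ _).trans ?_
  have h : ∑ i, ‖(star x) i * y i‖ = ∑ i, ‖x i‖ * ‖y i‖ :=
    Finset.sum_congr rfl fun i _ => by rw [norm_mul, Pi.star_apply, norm_star]
  rw [h]
  exact (le_abs_self _).trans (Real.abs_le_sqrt (Finset.sum_mul_sq_le_sq_mul_sq _ _ _))

/-- Sesquilinearity of `⟨x, M w⟩` under scaling of both vectors. [folklore] -/
theorem star_smul_dotProduct_mulVec_smul (a b : ℂ) (x w : ι → ℂ) (M : Matrix ι ι ℂ) :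
    star (a • x) ⬝ᵥ M *ᵥ (b • w) = starRingEnd ℂ a * b * (star x ⬝ᵥ M *ᵥ w) := by
  rw [star_smul, mulVec_smul, smul_dotProduct, dotProduct_smul, smul_smul, smul_eq_mul,
    Complex.star_def]

/-- Normalisation: for `x ≠ 0`, `x / ‖x‖` is a unit vector. [folklore] -/
theorem star_dotProduct_self_normalize {x : ι → ℂ} (hx : x ≠ 0) :
    star ((((Real.sqrt (star x ⬝ᵥ x).re)⁻¹ : ℝ) : ℂ) • x) ⬝ᵥ
      ((((Real.sqrt (star x ⬝ᵥ x).re)⁻¹ : ℝ) : ℂ) • x) = 1 := by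
  have hN := EigenvalueContinuation.re_star_dotProduct_self_pos hx
  have hxx := star_dotProduct_self_ofReal x
  set N := (star x ⬝ᵥ x).re
  rw [star_smul_dotProduct_smul, hxx, Complex.norm_real, Real.norm_eq_abs, sq_abs, inv_pow,
    Real.sq_sqrt hN.le, ← Complex.ofReal_mul, inv_mul_cancel₀ hN.ne', Complex.ofReal_one]

/-- A form bound on unit vectors scales to all vectors: `|⟨x, M w⟩| ≤ C ‖x‖ ‖w‖`. [folklore] -/
theorem norm_form_le_of_unit (M : Matrix ι ι ℂ) {C : ℝ}
    (hM : ∀ x w : ι → ℂ, star x ⬝ᵥ x = 1 → star w ⬝ᵥ w = 1 → ‖star x ⬝ᵥ M *ᵥ w‖ ≤ C)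
    (x w : ι → ℂ) :
    ‖star x ⬝ᵥ M *ᵥ w‖ ≤ C * Real.sqrt (star x ⬝ᵥ x).re * Real.sqrt (star w ⬝ᵥ w).re := by
  by_cases hx : x = 0
  · simp [hx]
  by_cases hw : w = 0
  · simp [hw]
  set nx := Real.sqrt (star x ⬝ᵥ x).re with hnx
  set nw := Real.sqrt (star w ⬝ᵥ w).re with hnw
  have hnx0 : 0 < nx := Real.sqrt_pos.2 (EigenvalueContinuation.re_star_dotProduct_self_pos hx)
  have hnw0 : 0 < nw := Real.sqrt_pos.2 (EigenvalueContinuation.re_star_dotProduct_self_pos hw)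
  have hux := star_dotProduct_self_normalize hx
  have huw := star_dotProduct_self_normalize hw
  rw [← hnx] at hux
  rw [← hnw] at huw
  have key : star x ⬝ᵥ M *ᵥ w = ((nx * nw : ℝ) : ℂ) *
      (star (((nx⁻¹ : ℝ) : ℂ) • x) ⬝ᵥ M *ᵥ (((nw⁻¹ : ℝ) : ℂ) • w)) := by
    rw [star_smul_dotProduct_mulVec_smul, Complex.conj_ofReal, ← mul_assoc, ← Complex.ofReal_mul,
      ← Complex.ofReal_mul, show nx * nw * (nx⁻¹ * nw⁻¹) = 1 by field_simp, Complex.ofReal_one,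
      one_mul]
  rw [key, norm_mul, Complex.norm_real, Real.norm_eq_abs, abs_of_pos (mul_pos hnx0 hnw0)]
  calc nx * nw * ‖star (((nx⁻¹ : ℝ) : ℂ) • x) ⬝ᵥ M *ᵥ (((nw⁻¹ : ℝ) : ℂ) • w)‖
      ≤ nx * nw * C := mul_le_mul_of_nonneg_left (hM _ _ hux huw) (mul_pos hnx0 hnw0).le
    _ = C * nx * nw := by ring

/-- For Hermitian `A` and an eigenvector `A x = E x` with `E` real: `⟨x, A y⟩ = E ⟨x, y⟩`.
[folklore] -/
theorem star_eigen_dotProduct_mulVec {A : Matrix ι ι ℂ} (hA : A.IsHermitian) {x : ι → ℂ}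
    {E : ℝ} (hx : A *ᵥ x = ((E : ℝ) : ℂ) • x) (y : ι → ℂ) :
    star x ⬝ᵥ A *ᵥ y = (E : ℂ) * (star x ⬝ᵥ y) := by
  rw [EigenvalueContinuation.star_dotProduct_mulVec_comm hA.eq, hx, dotProduct_smul, smul_eq_mul,
    star_mul',
    ← star_dotProduct, Complex.star_def, Complex.conj_ofReal]

/-! ### Expansions along an orthonormal pair -/

/-- `⟨x₁ e₁ + x₂ e₂, w⟩ = x̄₁ ⟨e₁, w⟩ + x̄₂ ⟨e₂, w⟩`. [folklore] -/
theorem star_frame_dotProduct (e₁ e₂ w : ι → ℂ) (x₁ x₂ : ℂ) :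
    star (x₁ • e₁ + x₂ • e₂) ⬝ᵥ w =
      starRingEnd ℂ x₁ * (star e₁ ⬝ᵥ w) + starRingEnd ℂ x₂ * (star e₂ ⬝ᵥ w) := by
  rw [star_add, star_smul, star_smul, add_dotProduct, smul_dotProduct, smul_dotProduct,
    smul_eq_mul, smul_eq_mul, Complex.star_def]

/-- `⟨w, y₁ e₁ + y₂ e₂⟩ = y₁ ⟨w, e₁⟩ + y₂ ⟨w, e₂⟩` (for any left factor `w`). [folklore] -/
theorem dotProduct_frame (e₁ e₂ w : ι → ℂ) (y₁ y₂ : ℂ) :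
    w ⬝ᵥ (y₁ • e₁ + y₂ • e₂) = y₁ * (w ⬝ᵥ e₁) + y₂ * (w ⬝ᵥ e₂) := by
  rw [dotProduct_add, dotProduct_smul, dotProduct_smul, smul_eq_mul, smul_eq_mul]

/-- `M (y₁ e₁ + y₂ e₂) = y₁ M e₁ + y₂ M e₂`. [folklore] -/
theorem mulVec_frame (M : Matrix ι ι ℂ) (e₁ e₂ : ι → ℂ) (y₁ y₂ : ℂ) :
    M *ᵥ (y₁ • e₁ + y₂ • e₂) = y₁ • M *ᵥ e₁ + y₂ • M *ᵥ e₂ := by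
  rw [mulVec_add, mulVec_smul, mulVec_smul]

/-- A common eigenvalue passes to the plane: `A e_k = E e_k ⇒ A (y₁e₁ + y₂e₂) = E (y₁e₁ + y₂e₂)`.
[folklore] -/
theorem mulVec_frame_eigen {A : Matrix ι ι ℂ} {e₁ e₂ : ι → ℂ} {E : ℂ} (h₁ : A *ᵥ e₁ = E • e₁)
    (h₂ : A *ᵥ e₂ = E • e₂) (y₁ y₂ : ℂ) :
    A *ᵥ (y₁ • e₁ + y₂ • e₂) = E • (y₁ • e₁ + y₂ • e₂) := by
  rw [mulVec_frame, h₁, h₂, smul_add, smul_comm E y₁, smul_comm E y₂]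

section Frame

variable {e₁ e₂ : ι → ℂ} (he₁ : star e₁ ⬝ᵥ e₁ = 1) (he₂ : star e₂ ⬝ᵥ e₂ = 1)
  (he₁₂ : star e₁ ⬝ᵥ e₂ = 0)
include he₁₂

/-- `⟨e₂, e₁⟩ = 0`. [folklore] -/
theorem frame_orth₂₁ : star e₂ ⬝ᵥ e₁ = 0 := by
  rw [star_dotProduct_comm_conj, he₁₂, map_zero]

include he₁ he₂

/-- Gram identity of an orthonormal pair: `⟨x₁e₁ + x₂e₂, y₁e₁ + y₂e₂⟩ = x̄₁y₁ + x̄₂y₂`.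
[folklore] -/
theorem frame_gram (x₁ x₂ y₁ y₂ : ℂ) :
    star (x₁ • e₁ + x₂ • e₂) ⬝ᵥ (y₁ • e₁ + y₂ • e₂) =
      starRingEnd ℂ x₁ * y₁ + starRingEnd ℂ x₂ * y₂ := by
  rw [star_frame_dotProduct, dotProduct_frame, dotProduct_frame, he₁, he₂, he₁₂,
    frame_orth₂₁ he₁₂]
  ring

/-- `⟨x₁e₁ + x₂e₂, x₁e₁ + x₂e₂⟩ = |x₁|² + |x₂|²`. [folklore] -/
theorem frame_normSq (x₁ x₂ : ℂ) :
    star (x₁ • e₁ + x₂ • e₂) ⬝ᵥ (x₁ • e₁ + x₂ • e₂) = ((‖x₁‖ ^ 2 + ‖x₂‖ ^ 2 : ℝ) : ℂ) := by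
  rw [frame_gram he₁ he₂ he₁₂, Complex.conj_mul', Complex.conj_mul']
  push_cast
  ring

/-- A unit vector of the coefficient plane gives a unit vector `x₁e₁ + x₂e₂`. [folklore] -/
theorem frame_unit {x₁ x₂ : ℂ} (hx : ‖x₁‖ ^ 2 + ‖x₂‖ ^ 2 = 1) :
    star (x₁ • e₁ + x₂ • e₂) ⬝ᵥ (x₁ • e₁ + x₂ • e₂) = 1 := by
  rw [frame_normSq he₁ he₂ he₁₂, hx, Complex.ofReal_one]

/-- **Decomposition along the pair.** For a unit vector `ψ` with `c_k = ⟨e_k, ψ⟩`, the remainder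
`χ = ψ - (c₁e₁ + c₂e₂)` is orthogonal to `e₁, e₂` and `‖χ‖² = 1 - |c₁|² - |c₂|²` (Pythagoras).
[folklore] -/
theorem frame_decomp {ψ : ι → ℂ} (hψ : star ψ ⬝ᵥ ψ = 1) {c₁ c₂ : ℂ} (hc₁ : star e₁ ⬝ᵥ ψ = c₁)
    (hc₂ : star e₂ ⬝ᵥ ψ = c₂) :
    star e₁ ⬝ᵥ (ψ - (c₁ • e₁ + c₂ • e₂)) = 0 ∧ star e₂ ⬝ᵥ (ψ - (c₁ • e₁ + c₂ • e₂)) = 0 ∧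
      (star (ψ - (c₁ • e₁ + c₂ • e₂)) ⬝ᵥ (ψ - (c₁ • e₁ + c₂ • e₂))).re =
        1 - ‖c₁‖ ^ 2 - ‖c₂‖ ^ 2 := by
  have h₁ : star e₁ ⬝ᵥ (ψ - (c₁ • e₁ + c₂ • e₂)) = 0 := by
    rw [dotProduct_sub, dotProduct_frame, hc₁, he₁, he₁₂]
    ring
  have h₂ : star e₂ ⬝ᵥ (ψ - (c₁ • e₁ + c₂ • e₂)) = 0 := by
    rw [dotProduct_sub, dotProduct_frame, hc₂, he₂, frame_orth₂₁ he₁₂]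
    ring
  refine ⟨h₁, h₂, ?_⟩
  -- `⟨χ, χ⟩ = ⟨χ, ψ⟩ - ⟨χ, v⟩ = ⟨χ, ψ⟩ = conj ⟨ψ, χ⟩ = conj (⟨ψ, ψ⟩ - ⟨ψ, v⟩)`
  have hχv : star (ψ - (c₁ • e₁ + c₂ • e₂)) ⬝ᵥ (c₁ • e₁ + c₂ • e₂) = 0 := by
    rw [dotProduct_frame, star_dotProduct_comm_conj e₁, star_dotProduct_comm_conj e₂, h₁, h₂,
      map_zero, mul_zero, mul_zero, add_zero]
  have hψv : star ψ ⬝ᵥ (c₁ • e₁ + c₂ • e₂) = ((‖c₁‖ ^ 2 + ‖c₂‖ ^ 2 : ℝ) : ℂ) := by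
    rw [dotProduct_frame, star_dotProduct_comm_conj e₁ ψ, star_dotProduct_comm_conj e₂ ψ, hc₁, hc₂,
      Complex.mul_conj', Complex.mul_conj']
    push_cast
    ring
  have : star (ψ - (c₁ • e₁ + c₂ • e₂)) ⬝ᵥ (ψ - (c₁ • e₁ + c₂ • e₂)) =
      ((1 - ‖c₁‖ ^ 2 - ‖c₂‖ ^ 2 : ℝ) : ℂ) := by
    rw [dotProduct_sub, hχv, sub_zero, star_dotProduct_comm_conj, dotProduct_sub, hψ, hψv,
      ← Complex.ofReal_one, ← Complex.ofReal_sub, Complex.conj_ofReal]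
    push_cast
    ring
  rw [this, Complex.ofReal_re]

/-- The frame weight of a unit vector is at most `1`. [folklore] -/
theorem frame_weight_le_one {ψ : ι → ℂ} (hψ : star ψ ⬝ᵥ ψ = 1) :
    ‖star e₁ ⬝ᵥ ψ‖ ^ 2 + ‖star e₂ ⬝ᵥ ψ‖ ^ 2 ≤ 1 := by
  have h := (frame_decomp he₁ he₂ he₁₂ hψ rfl rfl).2.2
  have h0 := EigenvalueContinuation.re_star_dotProduct_self_nonneg
    (ψ - ((star e₁ ⬝ᵥ ψ) • e₁ + (star e₂ ⬝ᵥ ψ) • e₂))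
  linarith

end Frame

/-! ### The compression to the plane and the pencil `[[a, b], [b̄, -a]]` -/

/-- **Compression formula.** With `s_kl = ⟨e_k, W e_l⟩`, `α = (re s₁₁ + re s₂₂)/2`,
`a = (re s₁₁ - re s₂₂)/2`, `b = (s₁₂ + conj s₂₁)/2`:
`re ⟨x₁e₁ + x₂e₂, W (x₁e₁ + x₂e₂)⟩ = α (|x₁|² + |x₂|²) + a (|x₁|² - |x₂|²) + 2 re (x̄₁ x₂ b)`
(no orthonormality needed). [folklore] -/
theorem compression_re (W : Matrix ι ι ℂ) (e₁ e₂ : ι → ℂ) (x₁ x₂ : ℂ) {α a : ℝ} {b : ℂ}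
    (hα : α = ((star e₁ ⬝ᵥ W *ᵥ e₁).re + (star e₂ ⬝ᵥ W *ᵥ e₂).re) / 2)
    (ha : a = ((star e₁ ⬝ᵥ W *ᵥ e₁).re - (star e₂ ⬝ᵥ W *ᵥ e₂).re) / 2)
    (hb : b = (star e₁ ⬝ᵥ W *ᵥ e₂ + star (star e₂ ⬝ᵥ W *ᵥ e₁)) / 2) :
    (star (x₁ • e₁ + x₂ • e₂) ⬝ᵥ W *ᵥ (x₁ • e₁ + x₂ • e₂)).re =
      α * (‖x₁‖ ^ 2 + ‖x₂‖ ^ 2) +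
        (a * (‖x₁‖ ^ 2 - ‖x₂‖ ^ 2) + 2 * (starRingEnd ℂ x₁ * x₂ * b).re) := by
  subst hα ha hb
  rw [mulVec_frame, star_frame_dotProduct, dotProduct_frame, dotProduct_frame]
  set s₁₁ := star e₁ ⬝ᵥ W *ᵥ e₁
  set s₁₂ := star e₁ ⬝ᵥ W *ᵥ e₂
  set s₂₁ := star e₂ ⬝ᵥ W *ᵥ e₁
  set s₂₂ := star e₂ ⬝ᵥ W *ᵥ e₂
  simp only [Complex.sq_norm, Complex.normSq_apply, Complex.add_re, Complex.mul_re,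
    Complex.mul_im, Complex.conj_re, Complex.conj_im, Complex.star_def, Complex.div_ofNat_re,
    Complex.div_ofNat_im, Complex.add_im]
  ring

/-- **Pencil bound.** For the traceless Hermitian `2 × 2` matrix `[[a, b], [b̄, -a]]`
(eigenvalues `±√(a² + |b|²)`) and `x ∈ ℂ²`:
`|a(|x₁|² - |x₂|²) + 2 re(x̄₁ x₂ b)| ≤ √(a² + |b|²) (|x₁|² + |x₂|²)` (Cauchy–Schwarz in `ℝ²`,
`(|x₁|² - |x₂|²)² + (2|x₁||x₂|)² = (|x₁|² + |x₂|²)²`). [folklore] -/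
theorem abs_pencil_le (a : ℝ) (b x₁ x₂ : ℂ) :
    |a * (‖x₁‖ ^ 2 - ‖x₂‖ ^ 2) + 2 * (starRingEnd ℂ x₁ * x₂ * b).re| ≤
      Real.sqrt (a ^ 2 + ‖b‖ ^ 2) * (‖x₁‖ ^ 2 + ‖x₂‖ ^ 2) := by
  have h1 := Complex.abs_re_le_norm (starRingEnd ℂ x₁ * x₂ * b)
  rw [norm_mul, norm_mul, Complex.norm_conj] at h1
  have hx₁ := norm_nonneg x₁
  have hx₂ := norm_nonneg x₂
  have hb := norm_nonneg b
  have key : (|a| * |‖x₁‖ ^ 2 - ‖x₂‖ ^ 2| + ‖b‖ * (2 * ‖x₁‖ * ‖x₂‖)) ^ 2 ≤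
      (a ^ 2 + ‖b‖ ^ 2) * (‖x₁‖ ^ 2 + ‖x₂‖ ^ 2) ^ 2 := by
    have hPQ : (‖x₁‖ ^ 2 + ‖x₂‖ ^ 2) ^ 2 =
        |‖x₁‖ ^ 2 - ‖x₂‖ ^ 2| ^ 2 + (2 * ‖x₁‖ * ‖x₂‖) ^ 2 := by
      rw [sq_abs]; ring
    rw [hPQ]
    nlinarith [sq_nonneg (|a| * (2 * ‖x₁‖ * ‖x₂‖) - ‖b‖ * |‖x₁‖ ^ 2 - ‖x₂‖ ^ 2|), sq_abs a,
      abs_nonneg a, abs_nonneg (‖x₁‖ ^ 2 - ‖x₂‖ ^ 2)]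
  have key' : |a| * |‖x₁‖ ^ 2 - ‖x₂‖ ^ 2| + ‖b‖ * (2 * ‖x₁‖ * ‖x₂‖) ≤
      Real.sqrt (a ^ 2 + ‖b‖ ^ 2) * (‖x₁‖ ^ 2 + ‖x₂‖ ^ 2) := by
    have h := Real.abs_le_sqrt key
    rw [Real.sqrt_mul (by positivity), Real.sqrt_sq (by positivity)] at h
    exact (le_abs_self _).trans h
  calc |a * (‖x₁‖ ^ 2 - ‖x₂‖ ^ 2) + 2 * (starRingEnd ℂ x₁ * x₂ * b).re|
      ≤ |a * (‖x₁‖ ^ 2 - ‖x₂‖ ^ 2)| + |2 * (starRingEnd ℂ x₁ * x₂ * b).re| := abs_add_le _ _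
    _ ≤ |a| * |‖x₁‖ ^ 2 - ‖x₂‖ ^ 2| + ‖b‖ * (2 * ‖x₁‖ * ‖x₂‖) := by
        rw [abs_mul, abs_mul, abs_two]
        nlinarith [h1]
    _ ≤ _ := key'

/-- The pencil form is at least `-√(a² + |b|²)` on unit vectors. [folklore] -/
theorem neg_sqrt_le_pencil (a : ℝ) (b : ℂ) {x₁ x₂ : ℂ} (hx : ‖x₁‖ ^ 2 + ‖x₂‖ ^ 2 = 1) :
    -Real.sqrt (a ^ 2 + ‖b‖ ^ 2) ≤
      a * (‖x₁‖ ^ 2 - ‖x₂‖ ^ 2) + 2 * (starRingEnd ℂ x₁ * x₂ * b).re := by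
  have h := abs_pencil_le a b x₁ x₂
  rw [hx, mul_one] at h
  exact (abs_le.1 h).1

/-- The pencil form is at most `√(a² + |b|²)` on unit vectors. [folklore] -/
theorem pencil_le_sqrt (a : ℝ) (b : ℂ) {x₁ x₂ : ℂ} (hx : ‖x₁‖ ^ 2 + ‖x₂‖ ^ 2 = 1) :
    a * (‖x₁‖ ^ 2 - ‖x₂‖ ^ 2) + 2 * (starRingEnd ℂ x₁ * x₂ * b).re ≤
      Real.sqrt (a ^ 2 + ‖b‖ ^ 2) := by
  have h := abs_pencil_le a b x₁ x₂
  rw [hx, mul_one] at h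
  exact (abs_le.1 h).2

/-- The algebra of the lower eigenvector `(b, -(a + ρ)) / n` of the pencil. [folklore] -/
private theorem pencil_minimizer_identity {a ρ β m : ℝ} (hβ : β ^ 2 = ρ ^ 2 - a ^ 2)
    (hm : m ^ 2 * (β ^ 2 + (a + ρ) ^ 2) = 1) :
    a * ((m * β) ^ 2 - (-(a + ρ) * m) ^ 2) + 2 * (m * (-(a + ρ) * m) * β ^ 2) = -ρ := by
  linear_combination (-m ^ 2 * (a + ρ)) * hβ + (-ρ) * hm

/-- **Lower eigenvector of the pencil.** The pencil form attains `-√(a² + |b|²)` on the unit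
sphere of `ℂ²`: at `(b, -(a + ρ))/‖·‖` if `b ≠ 0`, at a coordinate vector if `b = 0`.
[folklore] -/
theorem exists_pencil_eq_neg_sqrt (a : ℝ) (b : ℂ) :
    ∃ x₁ x₂ : ℂ, ‖x₁‖ ^ 2 + ‖x₂‖ ^ 2 = 1 ∧
      a * (‖x₁‖ ^ 2 - ‖x₂‖ ^ 2) + 2 * (starRingEnd ℂ x₁ * x₂ * b).re =
        -Real.sqrt (a ^ 2 + ‖b‖ ^ 2) := by
  by_cases hb : b = 0
  · subst hb
    have hρ : Real.sqrt (a ^ 2 + ‖(0 : ℂ)‖ ^ 2) = |a| := by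
      rw [norm_zero, zero_pow two_ne_zero, add_zero, Real.sqrt_sq_eq_abs]
    rw [hρ]
    rcases le_or_gt 0 a with ha | ha
    · refine ⟨0, 1, by simp, ?_⟩
      simp [abs_of_nonneg ha]
    · refine ⟨1, 0, by simp, ?_⟩
      simp [abs_of_neg ha]
  · set ρ := Real.sqrt (a ^ 2 + ‖b‖ ^ 2) with hρ
    have hb0 : 0 < ‖b‖ := norm_pos_iff.2 hb
    have hρ2 : ‖b‖ ^ 2 = ρ ^ 2 - a ^ 2 := by
      rw [hρ, Real.sq_sqrt (by positivity)]; ring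
    have hn0 : 0 < ‖b‖ ^ 2 + (a + ρ) ^ 2 := by positivity
    set m := (Real.sqrt (‖b‖ ^ 2 + (a + ρ) ^ 2))⁻¹ with hm
    have hm0 : 0 < m := inv_pos.2 (Real.sqrt_pos.2 hn0)
    have hm2 : m ^ 2 * (‖b‖ ^ 2 + (a + ρ) ^ 2) = 1 := by
      rw [hm, inv_pow, Real.sq_sqrt hn0.le, inv_mul_cancel₀ hn0.ne']
    refine ⟨((m : ℝ) : ℂ) * b, ((-(a + ρ) * m : ℝ) : ℂ), ?_, ?_⟩
    · rw [norm_mul, Complex.norm_real, Complex.norm_real, Real.norm_eq_abs, Real.norm_eq_abs,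
        abs_of_pos hm0, sq_abs]
      linear_combination hm2
    · have hre : (starRingEnd ℂ (((m : ℝ) : ℂ) * b) * ((-(a + ρ) * m : ℝ) : ℂ) * b).re =
          m * (-(a + ρ) * m) * ‖b‖ ^ 2 := by
        have : starRingEnd ℂ (((m : ℝ) : ℂ) * b) * ((-(a + ρ) * m : ℝ) : ℂ) * b =
            ((m * (-(a + ρ) * m) * ‖b‖ ^ 2 : ℝ) : ℂ) := by
          rw [map_mul, Complex.conj_ofReal]
          push_cast
          rw [← Complex.conj_mul' b]
          ring
        rw [this, Complex.ofReal_re]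
      rw [hre, norm_mul, Complex.norm_real, Complex.norm_real, Real.norm_eq_abs, Real.norm_eq_abs,
        abs_of_pos hm0, sq_abs]
      exact pencil_minimizer_identity hρ2 hm2

end Summit.HubbardSuperconductivity.HubbardSuperconductivity.Theorems.NodalDiracTwist
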